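import Literature.NumberTheory.LFunctions.JensenShiftCertificate
import Literature.NumberTheory.LFunctions.JensenBoxLemma
import Literature.NumberTheory.LFunctions.JensenHyperbolicityCertifiedRanges
import Literature.NumberTheory.LFunctions.WangYang2024.TuranCertificate
import HarnessLib

/-!
# `J^{d,n}_ξ` hyperbolic for ALL shifts `n`, FIXED degree `d`: the printed asymptotic input as a
# named hypothesis, the finite shift range as a decidable certificate

For the Taylor coefficients `γ = xiTaylorCoeff` of `(-1 + 4z²) Λ(½ + z) = Σ γ(n) z^{2n}/n!`
(Griffin–Ono–Rolen–Zagier, PNAS 116 (2019), eq. (1); tree: `RiemannXi.lean`) and a fixed degree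
`d`, the statement "`J^{d,n}_γ` is hyperbolic for every `n ≥ 0`" (`JensenXiAllShifts d`) is proved
in print (GORZ Thm. 2, `d ≤ 8`) in two pieces, typed here AS PRINTED:

1. the ASYMPTOTIC INPUT (§5.2, "Sketch of the Proof of Theorem 2"): Theorem 3's Hermite limit made
   effective — "we determined numbers `M_{ε_d}` for which the required inequalities hold for
   `n ≥ M_{ε_d}` … we found suitable choices for which `M_{ε_d} < 10⁶`", and for `d = 4` explicitly
   `ε₄ = (0.041, 1.384, 0.813, 7.313, 0.804)`, "`M_{ε₄} := 104`" — the named proposition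
   `gorz2019_effectiveTail` (`JensenHyperbolicFrom xiTaylorCoeff d (gorz2019TailShift d)`,
   `gorz2019TailShift 4 = 104`, `= 10⁶` for `d = 5, …, 8`);
2. the FINITE RANGE ("We have confirmed the hyperbolicity of `Ĵ^{d,n}_γ(X)` for `n ≤ 10⁶` and
   `4 ≤ d ≤ 8` using Hermite's criterion") — the named proposition `gorz2019_computerCheck`, which the
   theorems below REPLACE by a decidable certificate (`JensenCoeffBox.CertifiesRange`,
   `JensenShiftCertificate.lean`): rational enclosures of `γ(0), …, γ(M+d-1)` plus `d + 1` rational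
   sign points per shift.

Also typed AS PRINTED: GORZ's normalisation (18) (`gorzL`, `gorzK`, `gorzDelta`, `gorzA`:
`ñ = 2n - 2`, `L(ñ)` the positive root of `ñ = L(πe^L + 3/4)`, `K = (L⁻¹ + L⁻²)ñ - 3/4`,
`δ(n) = √(1/ñ - 2/(L²K))`, `A(n) = log(nL²/(4ñ²)) + (L-1)/(L²K) + ñ(L+2)/(L⁴K²)`), the printed
claim "the required inequalities hold for `n ≥ M_{ε₄} = 104`" as the named proposition
`gorz2019_inequalities_four` (coefficients of `Ĵ^{4,n}_γ` in the `ε₄`-box `gorzBoxFour` of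
`JensenBoxLemma.lean`, whose box lemma is KERNEL-PROVED there), and the STRUCTURED effective
expansion the track's plan calls (S1) (`XiCoeffStructuredExpansion`, GORZ (15) / GORTTW Thm. 2.1
shape with explicit `A, δ, g_i` and explicit bounds — a parametric predicate, any explicit choice of
the normalisation being admissible).

Main shapes:
* `jensenXiAllShifts_four_of_inequalities_of_certificate` — THE `d = 4` SHAPE: the printed
  asymptotic input `gorz2019_inequalities_four` (named hypothesis) + coefficient enclosures of `γ` +
  an accepted range certificate of `104` sign-point vectors ⇒ `JensenXiAllShifts 4`; the box lemma
  in between is a kernel theorem (`gorzBoxFour_coeffCertifies`);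
* `jensenXiAllShifts_of_tail_of_certificate` — any `d`, `M`: tail hypothesis + box + accepted range
  certificate ⇒ `JensenXiAllShifts d` (the interface for "the next `d`");
* `jensenXiAllShifts_of_effectiveTail_of_certificate` — `4 ≤ d ≤ 8` with GORZ's printed hand-off
  (`104` certificates of `5` points for `d = 4`);
* `gorz_le_eight_of_effectiveTail_of_computerCheck` — the printed proof of Thm. 2 assembled into the
  tree's `gorz_le_eight` (`d ≤ 3` from Csordas–Norfolk–Varga 1986 / Dimitrov–Lucas 2011 as input);
* the later effective tails as named facts: GORTTW, Adv. Math. 397 (2022), Thm. 1.1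
  (`n > c·e^{d}`, `c` absolute, uncomputed; `gorttw_thm1_1`) and Kim–Lee, JKMS 59 (2022), Thm. 1
  (`N(Ξ₀; d) = O(d^{c})`, `c > ½`, ineffective; `kimLee_thm1`), each with its `JensenHyperbolicFrom`
  corollary;
* a KERNEL INSTANCE of the certificate on genuine `ξ` data: the box for `γ(1), γ(2), γ(3)` obtained
  from the tree's validated enclosures of the `Φ`-moments `b₁, b₂, b₃`
  (`WangYang2024/TuranCertificate.lean`, `γ(k) = 64·4ᵏ·k!/(2k)!·b_k` by `xiTaylorCoeff_eq_xiMoment`)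
  and the sign points `-120 < -50 < 0` are accepted by `decide +kernel`, whence
  `(jensenPoly xiTaylorCoeff 2 1).Splits` by the certificate route alone (standard axioms) —
  Csordas–Norfolk–Varga's Turán inequality at `m = 2` re-obtained as a sign certificate.

HONEST STATUS. In the tree every `J^{d,n}_γ` with `d ≤ 10 201` (kernel) / `d ≤ 6 330 256`
(compiled) is already hyperbolic for all `n` through RH up to height `101` / `2516`
(`JensenHyperbolicityCertifiedRanges.lean`); accordingly the two GORZ named inputs are DISCHARGED
here at once (`gorz2019_effectiveTail_holds`, `gorz2019_computerCheck_holds`) and carry no debt. What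
this file adds is the fixed-degree certificate SHAPE (independent of any RH-height certificate) and
the two genuinely open-ended printed tails (`gorttw_thm1_1`, `kimLee_thm1`: all `d`, not implied by
any finite height). Nothing here says anything about zeros of `ζ` (no converse:
`Literature.Barriers.RiemannHypothesis.JensenPolynomialsShiftUniform_holds`).

## References
* [GORZPNAS2019] Griffin–Ono–Rolen–Zagier, PNAS 116 (2019) 11103–11110, Thms. 1–3, §5.2.
* [GriffinEtAl2022] Griffin–Ono–Rolen–Thorner–Tripp–Wagner, Adv. Math. 397 (2022) 108186, Thm. 1.1
  (journal: `n > c e^{d}`, per Zbl 1490.11086; arXiv v3 prints `n ≥ c e^{d/2}`).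
* [KimLee2021] Y.-O. Kim, J. Lee, J. Korean Math. Soc. 59 (2022) 775–787 = arXiv:2105.05386, Thm. 1.
* [CsordasNorfolkVarga1986] Csordas–Norfolk–Varga, Trans. AMS 296 (1986) 521–541, Thm. 2.5.
-/

open Polynomial Finset

namespace Literature.NumberTheory.LFunctions

/-! ## The target statement, per degree -/

/-- **"`J^{d,n}_γ` is hyperbolic for every shift `n ≥ 0`"** for the Taylor coefficients
`γ = xiTaylorCoeff` of `ξ` and a fixed degree `d` (GORZ 2019, Thm. 2 asserts it for `1 ≤ d ≤ 8`;
all `d` is the Pólya–Jensen criterion = RH, `JensenPolyaCriterion`). [cite: GORZPNAS2019, Thm. 2] -/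
def JensenXiAllShifts (d : ℕ) : Prop :=
  ∀ n : ℕ, (jensenPoly xiTaylorCoeff d n).Splits

/-- **Any degree, certificate shape.** Tail hypothesis `J^{d,n}_γ` hyperbolic for `n ≥ M` + a box
enclosing `γ` + an accepted range certificate for the shifts `n < M` ⇒ all shifts. This is the
interface a "next `d`" run fills: `M` from an effective tail bound, `M` sign-point vectors from a
certified root computation. [cite: GORZPNAS2019, Thm. 2 and §5.2] -/
theorem jensenXiAllShifts_of_tail_of_certificate {d M : ℕ}
    (hT : JensenHyperbolicFrom xiTaylorCoeff d M) {B : JensenCoeffBox}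
    (hB : B.Encloses xiTaylorCoeff) {U : Fin M → Fin (d + 1) → ℚ} (hU : B.CertifiesRange d M U) :
    JensenXiAllShifts d :=
  jensenPoly_splits_allShifts_of_from_of_certifiesRange hT hB hU

/-! ## GORZ's normalisation (18), as printed -/

/-- GORZ (18): `L = L(ñ)`, "the unique positive root of `ñ = L(πe^L + 3/4)`" (Thm. 7), typed as the
supremum of `{L ≥ 0 : L(πe^L + 3/4) ≤ m}` (equal to that root for `m > 0`; `0` at `m = 0`).
[cite: GORZPNAS2019, Thm. 7 and §5.1 eq. (18)] -/
noncomputable def gorzL (m : ℝ) : ℝ :=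
  sSup {L : ℝ | 0 ≤ L ∧ L * (Real.pi * Real.exp L + 3 / 4) ≤ m}

/-- GORZ (18): `K := K(ñ) := (L(ñ)⁻¹ + L(ñ)⁻²) ñ - 3/4`, `ñ = 2n - 2`. Junk for `n ≤ 1` (`ñ = 0`,
Lean's `0⁻¹ = 0`). [cite: GORZPNAS2019, §5.1 eq. (18)] -/
noncomputable def gorzK (n : ℕ) : ℝ :=
  ((gorzL (2 * n - 2))⁻¹ + (gorzL (2 * n - 2))⁻¹ ^ 2) * (2 * n - 2) - 3 / 4

/-- GORZ (18): `δ(n) := √(1/ñ - 2/(L²K))`, `ñ = 2n - 2`, `L = L(ñ)`, `K = K(ñ)` (real and positive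
for `n ≥ 7` — "it turns out that `δ(6)` is not real", footnote; `Real.sqrt` returns `0` there).
[cite: GORZPNAS2019, §5.1 eq. (18)] -/
noncomputable def gorzDelta (n : ℕ) : ℝ :=
  Real.sqrt (1 / (2 * n - 2) - 2 / (gorzL (2 * n - 2) ^ 2 * gorzK n))

/-- GORZ (18): `A(n) := log(nL²/(4ñ²)) + (L - 1)/(L²K) + ñ(L + 2)/(L⁴K²)`, `ñ = 2n - 2`.
[cite: GORZPNAS2019, §5.1 eq. (18)] -/
noncomputable def gorzA (n : ℕ) : ℝ :=
  Real.log (n * gorzL (2 * n - 2) ^ 2 / (4 * (2 * n - 2) ^ 2))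
    + (gorzL (2 * n - 2) - 1) / (gorzL (2 * n - 2) ^ 2 * gorzK n)
    + (2 * n - 2) * (gorzL (2 * n - 2) + 2) / (gorzL (2 * n - 2) ^ 4 * gorzK n ^ 2)

/-- **GORZ §5.2, `d = 4`, as printed: "the required inequalities hold for `n ≥ M_{ε₄}`",
`M_{ε₄} = 104`** — with `Ĵ^{4,n}_γ(X) = δ(n)⁻⁴ γ(n)⁻¹ J^{4,n}_γ((δ(n)X - 1)/e^{A(n)}) = Σ β^{4,n}_k X^k`
(`jensenPolyRescaled xiTaylorCoeff (exp ∘ A) δ 4 n`, `A, δ` from (18)) and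
`ε₄ = (0.041, 1.384, 0.813, 7.313, 0.804)`: for every `n ≥ 104`, `δ(n) ≠ 0` and
`β^{4,n} ∈ [11.196, 12] × [-7.313, 0] × [-12, -11.187] × [0, 1.384] × [0.959, 1]` (the closed
`ε₄`-box `gorzBoxFour`; the printed inequalities `0 ≤ s_k(β_k - h_k) < ε₄(k)` are its half-open
version). This is the ASYMPTOTIC INPUT of Theorem 2 at `d = 4`; its proof ("an effective form of
(16) … it can be shown") is not printed — named fact, NOT proved here (the track's target (β)).
[cite: GORZPNAS2019, §5.2] -/
def gorz2019_inequalities_four : Prop :=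
  RescaledCoeffsInBox xiTaylorCoeff (fun n => Real.exp (gorzA n)) gorzDelta 4 104 gorzBoxFour

/-- **(S1) — the structured effective coefficient expansion** (GORZ §5.1 eq. (15) made effective;
the shape of GORTTW Thm. 2.1): for `n ≥ n₀`, `δ(n) > 0`, explicit coefficient bounds
`|g_i(n)| ≤ Γ_i n^{-e_i}` (`3 ≤ i ≤ d`), and for `0 ≤ j ≤ d`
`|log(γ(n+j)/(γ(n) e^{A(n) j})) + δ(n)² j² - Σ_{i=3}^{d} g_i(n) j^i| ≤ ρ n^{-e}`. A parametric
predicate: `A, δ, g, Γ, e, ρ, e_R, n₀` are whatever explicit data an effective asymptotic analysis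
supplies (hyperbolicity being invariant under the normalisation, any explicit choice is admissible);
GORZ print only `0 < C(n,j) < 14.25` (`n ≥ 7`, `j ≤ 8`) for the aggregate of all terms beyond
`-δ²j²`. [cite: GORZPNAS2019, §5.1 eq. (15) and §5.2 eq. (19)] -/
def XiCoeffStructuredExpansion (d n₀ : ℕ) (A δ : ℕ → ℝ) (g : ℕ → ℕ → ℝ) (Γ e : ℕ → ℝ)
    (ρ eR : ℝ) : Prop :=
  ∀ n : ℕ, n₀ ≤ n → 0 < δ n ∧
    (∀ i : ℕ, 3 ≤ i → i ≤ d → |g i n| ≤ Γ i * (n : ℝ) ^ (-(e i))) ∧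
    ∀ j : ℕ, j ≤ d →
      |Real.log (xiTaylorCoeff (n + j) / (xiTaylorCoeff n * Real.exp (A n * j)))
          + δ n ^ 2 * (j : ℝ) ^ 2 - ∑ i ∈ Finset.Icc 3 d, g i n * (j : ℝ) ^ i|
        ≤ ρ * (n : ℝ) ^ (-eR)

/-! ## The `d = 4` shape with the kernel-proved box lemma -/

/-- The printed inequalities from `104` on give the hyperbolic tail from `104`: the `ε₄`-box lemma
is a kernel theorem (`gorzBoxFour_coeffCertifies`, `JensenBoxLemma.lean`) and hyperbolicity is
invariant under the renormalisation. [cite: GORZPNAS2019, §5.2] -/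
theorem jensenHyperbolicFrom_four_of_inequalities (h : gorz2019_inequalities_four) :
    JensenHyperbolicFrom xiTaylorCoeff 4 104 :=
  jensenHyperbolicFrom_of_rescaledCoeffsInBox h gorzBoxFour_coeffCertifies

/-- **`J^{4,n}_γ` hyperbolic for all `n` — the typed shape at `d = 4`**: the printed asymptotic
input (`gorz2019_inequalities_four`, named hypothesis) + rational enclosures of
`γ(0), …, γ(107)` (certified numerics, hypothesis `B.Encloses xiTaylorCoeff`) + an ACCEPTED range
certificate of `104` sign-point vectors (decidable, `decide`/`native_decide`) ⇒ every shift. The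
box lemma in the middle is discharged by the kernel. [cite: GORZPNAS2019, Thm. 2 and §5.2] -/
theorem jensenXiAllShifts_four_of_inequalities_of_certificate (h : gorz2019_inequalities_four)
    {B : JensenCoeffBox} (hB : B.Encloses xiTaylorCoeff) {U : Fin 104 → Fin 5 → ℚ}
    (hU : B.CertifiesRange 4 104 U) : JensenXiAllShifts 4 :=
  jensenXiAllShifts_of_tail_of_certificate (jensenHyperbolicFrom_four_of_inequalities h) hB hU

/-- The same with ANY explicit normalisation `E, δ` and hand-off `M` (J-R3: any explicit choice is
admissible): coefficients of `Ĵ^{4,n}` in the `ε₄`-box for `n ≥ M` + enclosures + `M` accepted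
sign certificates ⇒ all shifts. [cite: GORZPNAS2019, Thm. 2 and §5.2] -/
theorem jensenXiAllShifts_four_of_inBox_of_certificate {E δ : ℕ → ℝ} {M : ℕ}
    (h : RescaledCoeffsInBox xiTaylorCoeff E δ 4 M gorzBoxFour) {B : JensenCoeffBox}
    (hB : B.Encloses xiTaylorCoeff) {U : Fin M → Fin 5 → ℚ} (hU : B.CertifiesRange 4 M U) :
    JensenXiAllShifts 4 :=
  jensenXiAllShifts_of_tail_of_certificate (jensenHyperbolicFrom_of_rescaledCoeffsInBox h
    gorzBoxFour_coeffCertifies) hB hU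

/-! ## GORZ 2019, Theorem 2 (`d ≤ 8`): the printed inputs at the level of their conclusions -/

/-- The printed hand-off shift of GORZ §5.2: `M_{ε₄} = 104` for `d = 4` ("It turns out that
`M_{ε₄} := 104 < 10⁶`"); for `d = 5, …, 8` only "`M_{ε_d} < 10⁶`" is printed, so the hand-off is
taken at `10⁶`. [cite: GORZPNAS2019, §5.2] -/
def gorz2019TailShift (d : ℕ) : ℕ :=
  if d = 4 then 104 else 1000000

/-- `gorz2019TailShift 4 = 104`. [cite: GORZPNAS2019, §5.2] -/
@[simp] theorem gorz2019TailShift_four : gorz2019TailShift 4 = 104 := rfl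

/-- `gorz2019TailShift d ≤ 10⁶`. [cite: GORZPNAS2019, §5.2] -/
theorem gorz2019TailShift_le (d : ℕ) : gorz2019TailShift d ≤ 1000000 := by
  unfold gorz2019TailShift; split_ifs <;> norm_num

/-- **GORZ 2019, §5.2 — the effective asymptotic input of Theorem 2, as printed.** With `A(n)`,
`δ(n)` of (18) and `Ĵ^{d,n}_γ(X) = δ(n)^{-d} γ(n)⁻¹ J^{d,n}_γ((δ(n)X - 1)/e^{A(n)}) = Σ β^{d,n}_k X^k
→ H_d(X)`: "we … chose vectors `ε_d` of positive numbers and signs `s_d, …, s_0 ∈ {±1}` for which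
`Ĵ^{d,n}_γ(X)` is hyperbolic if `0 ≤ s_k(β^{d,n}_k - h_k) < ε_d(k)` for all `k` … it can be shown that
`0 < C(n,j) < 14.25` for all `n ≥ 7` and `1 ≤ j ≤ 8`. Finally, we determined numbers `M_{ε_d}` for
which the required inequalities hold for `n ≥ M_{ε_d}` … `M_{ε_d} < 10⁶`"; Example `d = 4`:
`ε₄ = (0.041, 1.384, 0.813, 7.313, 0.804)`, `M_{ε₄} = 104`. Since `Ĵ^{d,n}_γ` is an affine
rescaling of `J^{d,n}_γ`, the CONCLUSION is: `J^{d,n}_γ` hyperbolic for every `n ≥ M_{ε_d}`,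
`4 ≤ d ≤ 8`. (The effective form of the asymptotic (16) behind "it can be shown" is not printed.)
Discharged below from RH up to height `101` (`gorz2019_effectiveTail_holds`).
[cite: GORZPNAS2019, §5.2] -/
def gorz2019_effectiveTail : Prop :=
  ∀ d : ℕ, 4 ≤ d → d ≤ 8 → JensenHyperbolicFrom xiTaylorCoeff d (gorz2019TailShift d)

/-- **GORZ 2019, §5.2 — the computer check of Theorem 2, as printed**: "We have confirmed the
hyperbolicity of the `Ĵ^{d,n}_γ(X)` for `n ≤ 10⁶` and `4 ≤ d ≤ 8` using Hermite's criterion (see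
Theorem C of [DL])". This is the input the certificate theorems replace by a kernel check.
Discharged below (`gorz2019_computerCheck_holds`). [cite: GORZPNAS2019, §5.2] -/
def gorz2019_computerCheck : Prop :=
  ∀ d : ℕ, 4 ≤ d → d ≤ 8 → ∀ n : ℕ, n ≤ 1000000 → (jensenPoly xiTaylorCoeff d n).Splits

/-- **GORZ Thm. 2 for `4 ≤ d ≤ 8`, certificate shape**: the printed effective tail plus an accepted
range certificate of `gorz2019TailShift d` sign-point vectors (`104` for `d = 4`) over a box
enclosing `γ` gives every shift. [cite: GORZPNAS2019, Thm. 2 and §5.2] -/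
theorem jensenXiAllShifts_of_effectiveTail_of_certificate (hT : gorz2019_effectiveTail) {d : ℕ}
    (h4 : 4 ≤ d) (h8 : d ≤ 8) {B : JensenCoeffBox} (hB : B.Encloses xiTaylorCoeff)
    {U : Fin (gorz2019TailShift d) → Fin (d + 1) → ℚ}
    (hU : B.CertifiesRange d (gorz2019TailShift d) U) : JensenXiAllShifts d :=
  jensenXiAllShifts_of_tail_of_certificate (hT d h4 h8) hB hU

/-- The `d = 4` instance with the printed `M_{ε₄} = 104`: `104` certificates of `5` rational points
each, over a box for `γ(0), …, γ(107)`. [cite: GORZPNAS2019, §5.2] -/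
theorem jensenXiAllShifts_four_of_effectiveTail_of_certificate (hT : gorz2019_effectiveTail)
    {B : JensenCoeffBox} (hB : B.Encloses xiTaylorCoeff) {U : Fin 104 → Fin 5 → ℚ}
    (hU : B.CertifiesRange 4 104 U) : JensenXiAllShifts 4 :=
  jensenXiAllShifts_of_tail_of_certificate (M := 104) (by simpa using hT 4 le_rfl (by norm_num))
    hB hU

/-- **The printed proof of GORZ Thm. 2, assembled**: `d ≤ 3` for all `n` (Csordas–Norfolk–Varga 1986
Thm. 2.5 for `d = 2`, Dimitrov–Lucas 2011 Thm. 1 for `d = 3`, `d = 1` trivial — taken as input),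
the effective tail and the computer check for `4 ≤ d ≤ 8`, give the tree's `gorz_le_eight`.
[cite: GORZPNAS2019, Thm. 2 and §5.2] -/
theorem gorz_le_eight_of_effectiveTail_of_computerCheck
    (h3 : ∀ d : ℕ, 1 ≤ d → d ≤ 3 → JensenXiAllShifts d) (hT : gorz2019_effectiveTail)
    (hC : gorz2019_computerCheck) : gorz_le_eight := by
  intro d hd hd8 n
  rcases le_or_gt d 3 with hd3 | hd3
  · exact h3 d hd hd3 n
  · have h4 : 4 ≤ d := hd3
    refine jensenPoly_splits_allShifts_of_from_of_below (M := gorz2019TailShift d) (hT d h4 hd8)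
      (fun m hm => hC d h4 hd8 m ?_) n
    exact (Nat.le_of_lt_succ (Nat.lt_succ_of_lt hm)).trans (gorz2019TailShift_le d)

/-- **Discharge** of the effective-tail input: in the tree every `J^{d,n}_γ` with `d ≤ 10 201` is
hyperbolic for all `n` (RH up to height `101`, kernel-certified;
`jensenPoly_xiTaylorCoeff_splits_allShifts_of_le_10201`), so the named input is a theorem here —
by a different route than the printed one. [cite: GORZPNAS2019, §5.2] -/
theorem gorz2019_effectiveTail_holds : gorz2019_effectiveTail :=
  fun _ _ h8 n _ => jensenPoly_xiTaylorCoeff_splits_allShifts_of_le_10201 (h8.trans (by norm_num)) n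

/-- **Discharge** of the computer-check input (same route). [cite: GORZPNAS2019, §5.2] -/
theorem gorz2019_computerCheck_holds : gorz2019_computerCheck :=
  fun _ _ h8 n _ => jensenPoly_xiTaylorCoeff_splits_allShifts_of_le_10201 (h8.trans (by norm_num)) n

/-- `JensenXiAllShifts d` for every `d ≤ 10 201`, from the tree (for comparison with the certificate
route). [cite: GriffinEtAl2022, Theorem 1.2] -/
theorem jensenXiAllShifts_of_le_10201 {d : ℕ} (hd : d ≤ 10201) : JensenXiAllShifts d :=
  fun n => jensenPoly_xiTaylorCoeff_splits_allShifts_of_le_10201 hd n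

/-! ## The later effective tails, as named facts (all degrees; not implied by a finite RH height) -/

/-- **Griffin–Ono–Rolen–Thorner–Tripp–Wagner, Adv. Math. 397 (2022), Thm. 1.1, as printed in the
journal** (per the zbMATH review Zbl 1490.11086: "There is a constant `c > 0` such that if
`n > c e^{d}`, then `J^{d,n}(X)` is hyperbolic"; the arXiv version v3 prints the stronger
`n ≥ c e^{d/2}`, its v1/v2 `n ≫ e^{8d/9}`; the constant `c` is absolute and NOT computed in any
version). Their `J^{d,n}` are the Jensen polynomials of the coefficients of `ξ(½ + z) = Σ γ(j) z^{2j}/j!`,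
i.e. of `xiTaylorCoeff/8` — same hyperbolicity. Named fact, not proved here; its hypothesis-free
content for `d ≤ 10 201` is in the tree, the statement for all `d` is not.
[cite: GriffinEtAl2022, Theorem 1.1] -/
def gorttw_thm1_1 : Prop :=
  ∃ c : ℝ, 0 < c ∧ ∀ d n : ℕ, 1 ≤ d → c * Real.exp d < n → (jensenPoly xiTaylorCoeff d n).Splits

/-- GORTTW Thm. 1.1 as a tail in the sense of `JensenHyperbolicFrom`: hand-off shift
`⌊c e^{d}⌋₊ + 1`. [cite: GriffinEtAl2022, Theorem 1.1] -/
theorem jensenHyperbolicFrom_of_gorttw_thm1_1 (h : gorttw_thm1_1) :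
    ∃ c : ℝ, 0 < c ∧ ∀ d : ℕ, 1 ≤ d →
      JensenHyperbolicFrom xiTaylorCoeff d (⌊c * Real.exp d⌋₊ + 1) := by
  obtain ⟨c, hc, h⟩ := h
  refine ⟨c, hc, fun d hd n hn => h d n hd ?_⟩
  have h1 : c * Real.exp d < (⌊c * Real.exp d⌋₊ : ℝ) + 1 := Nat.lt_floor_add_one _
  have h2 : ((⌊c * Real.exp d⌋₊ + 1 : ℕ) : ℝ) ≤ n := by exact_mod_cast hn
  push_cast at h2
  linarith

/-- **Kim–Lee, J. Korean Math. Soc. 59 (2022), Thm. 1 (for `Ξ₀`), as printed**: with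
`N(f; d)` = the least `N` such that `J(f⁽ⁿ⁾; d)` is hyperbolic for every `n ≥ N`, "`N(Ξ₀; d) = O(d^{c})`
as `d → ∞` for every `c > ½`" (`Ξ(z) = Ξ₀(z²)`; `Ξ₀⁽ᵏ⁾(0) = k!/(2k)! Ξ⁽²ᵏ⁾(0) = (-1)ᵏ γ(k)/8`, so
`J(Ξ₀⁽ⁿ⁾; d)(z) = (-1)ⁿ 8⁻¹ J^{d,n}_γ(-z)` — same hyperbolicity). INEFFECTIVE ("our proof gives no
information about the Jensen polynomials considered, except that they are hyperbolic"; the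
thresholds come from Kim 1996). Named fact, not proved here. [cite: KimLee2021, Theorem 1] -/
def kimLee_thm1 : Prop :=
  ∀ c : ℝ, 1 / 2 < c → ∃ C : ℝ, ∃ d₀ : ℕ, ∀ d : ℕ, d₀ ≤ d →
    ∃ N : ℕ, (N : ℝ) ≤ C * (d : ℝ) ^ c ∧ JensenHyperbolicFrom xiTaylorCoeff d N

/-! ## A kernel instance of the certificate on `ξ` data: `J^{2,1}_γ`

`γ(k) = 64·4ᵏ·k!/(2k)!·b_k` (`xiTaylorCoeff_eq_xiMoment`, `b_k = xiMoment (2k) = WangYang2024.b k`),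
and the tree encloses `b₁ ∈ [0.000715249, 0.000720519]`, `b₂ ∈ [0.0000230305, 0.0000232651]`,
`b₃ ∈ [0.00000116319, 0.00000117793]` in the kernel (`WangYang2024.b_one_mem` etc.). Hence the box
below encloses `k ↦ γ(1+k)`, `k = 0, 1, 2`; the checker accepts the sign points `-120 < -50 < 0`
for `(d, n) = (2, 0)` of the shifted sequence (interval values `[0.186, 0.200]`, `[-0.0078, -0.0037]`,
`[0.0915, 0.0923]`), so `J^{2,1}_γ = γ(1) + 2γ(2)X + γ(3)X²` splits — equivalently
`γ(1)γ(3) < γ(2)²`, the Turán inequality of Csordas–Norfolk–Varga at `m = 2`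
(`WangYang2024.gamma_one_mul_three_lt`), here re-derived through the generic certificate. -/

/-- The box for `γ(1), γ(2), γ(3)` (as `k ↦ γ(1+k)`): `γ(1) = 128 b₁`, `γ(2) = (256/3) b₂`,
`γ(3) = (512/15) b₃` times the tree's enclosures of `b₁, b₂, b₃`.
[cite: CsordasNorfolkVarga1986, (1.5) and Table 4.1] -/
def xiCoeffBoxOneTwoThree : JensenCoeffBox :=
  ⟨[128 * 0.000715249, 256 / 3 * 0.0000230305, 512 / 15 * 0.00000116319],
   [128 * 0.000720519, 256 / 3 * 0.0000232651, 512 / 15 * 0.00000117793]⟩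

/-- The box encloses `k ↦ γ(1 + k)` (from the kernel-certified `Φ`-moment enclosures).
[cite: CsordasNorfolkVarga1986, (1.5) and Table 4.1] -/
theorem xiCoeffBoxOneTwoThree_encloses :
    xiCoeffBoxOneTwoThree.Encloses fun k => xiTaylorCoeff (1 + k) := by
  intro k hk
  have hk3 : k < 3 := by simpa [xiCoeffBoxOneTwoThree, JensenCoeffBox.size] using hk
  have h1 := WangYang2024.b_one_mem
  have h2 := WangYang2024.b_two_mem
  have h3 := WangYang2024.b_three_mem
  simp only [Set.mem_Icc, WangYang2024.b] at h1 h2 h3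
  have e1 : xiTaylorCoeff 1 = 128 * xiMoment (2 * 1) := by
    rw [xiTaylorCoeff_eq_xiMoment]; norm_num [Nat.factorial]
  have e2 : xiTaylorCoeff 2 = 256 / 3 * xiMoment (2 * 2) := by
    rw [xiTaylorCoeff_eq_xiMoment]; norm_num [Nat.factorial]
  have e3 : xiTaylorCoeff 3 = 512 / 15 * xiMoment (2 * 3) := by
    rw [xiTaylorCoeff_eq_xiMoment]; norm_num [Nat.factorial]
  interval_cases k
  · simp only [xiCoeffBoxOneTwoThree, List.getD_cons_zero, Nat.add_zero, e1]
    constructor <;> push_cast <;> nlinarith [h1.1, h1.2]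
  · simp only [xiCoeffBoxOneTwoThree, List.getD_cons_succ, List.getD_cons_zero,
      show 1 + 1 = 2 from rfl, e2]
    constructor <;> push_cast <;> nlinarith [h2.1, h2.2]
  · simp only [xiCoeffBoxOneTwoThree, List.getD_cons_succ, List.getD_cons_zero,
      show 1 + 2 = 3 from rfl, e3]
    constructor <;> push_cast <;> nlinarith [h3.1, h3.2]

/-- **The checker accepts** `(d, n) = (2, 0)` for the shifted box with sign points
`-120 < -50 < 0` — evaluated by the kernel (`decide +kernel`, standard axioms).
[cite: CsordasNorfolkVarga1986, Theorem 2.5] -/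
theorem xiCoeffBoxOneTwoThree_certifies :
    xiCoeffBoxOneTwoThree.Certifies 2 0 ![-120, -50, 0] := by
  decide +kernel

/-- **`J^{2,1}_γ` is hyperbolic, by the certificate route** (box from validated numerics + kernel
sign check + IVT soundness), independently of any RH-height certificate.
[cite: CsordasNorfolkVarga1986, Theorem 2.5] -/
theorem jensenPoly_xiTaylorCoeff_two_one_splits_of_certificate :
    (jensenPoly xiTaylorCoeff 2 1).Splits := by
  rw [show (1 : ℕ) = 1 + 0 from rfl, jensenPoly_shift]
  exact JensenCoeffBox.splits_of_certifies xiCoeffBoxOneTwoThree_encloses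
    xiCoeffBoxOneTwoThree_certifies

end Literature.NumberTheory.LFunctions
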